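import Summits.BirchSwinnertonDyer.BirchSwinnertonDyer.Theorems.ErratumRoadFiveShimuraSkolemPackage
import HarnessLib

/-!
# Route `ErratumRoadFive`, crux `EulerHalfOffLocus` (item stmt-BirchSwinnertonDyer-19062) — the
# receptacle-shaped Pasten package from the typer's Skolem-function facts, KEEPING Lemma 6.18
# (Papikian–Rabinoff: the cokernel at an odd prime of the level divides `q − 1`)

Cell `bsd-stepL` (run/shared/lean/pub/bsd-stepL/), seat `bsd-stepL-shim-p1` (prover g3),
`--supports stmt-BirchSwinnertonDyer-19062`.

`Theorems/ErratumRoadFiveShimuraSkolemPackage.lean` (g0, `ribetTakahashiPackage_of_componentOrders`)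
derives the kernel's receptacle shapes (P613), (Pij), (P68), (PEis) with the pin `δ ∅ = deg D₀` and an
EXISTENTIAL anchor from the typer's `Literature.NumberTheory.Automorphic.PastenShimura2024_componentOrders`
(Skolem functions `cI`, `cJ` with `ProductEq`, `Prop613`, `ImageEisenstein`, `CokernelDvd`) and
`PastenShimura2024_lemma_6_8_isogeny` — and DROPS the last clause `CokernelDvd` (Pasten 2024 Lemma 6.18:
"Let `p` be a prime with `p ∣ D`. Then `j_p(D,M)` divides `p − 1` if `p` is odd", from Papikian–Rabinoff
Cor. 3.5), which the kernel's telescoping at a non-Eisenstein prime did not need on the locus `p ∉ S`.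
With `p ∈ S` (the INERT line of `ErratumRoadFiveEulerHalfAlphaInert.lean`) it is exactly what removes the
parity side condition: the cokernel term `κ_S(p)` at the BSD prime itself divides `p − 1`, so it is a
`p`-adic unit, and the pair `{q, p}` can be peeled off `S` first (one (P613) step), after which `p` and the
(ram) witness are two multiplicative primes OUTSIDE the smaller level (Pasten Lemma 6.16). THIS FILE is
g0's theorem VERBATIM (same construction of `δ, cA, ι, κ` from the chosen class-minimal data) with the
ninth conjunct (P618) `∀ D ⊆ Mult(E) even, ∀ q ∈ D odd, κ D q ∣ q − 1` added and proved from `CokernelDvd`.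
-- adapted from Summits/BirchSwinnertonDyer/BirchSwinnertonDyer/Theorems/ErratumRoadFiveShimuraSkolemPackage.lean

HONEST FRAMING: CONDITIONAL on the named facts taken as hypotheses; no new definition, no named fact, no
`sorry`; nothing booked; BSD is not proved by any of this.
-/

noncomputable section

open scoped Classical

open WeierstrassCurve NumberField Literature.NumberTheory.EllipticCurves
  Literature.NumberTheory.EllipticCurves.ModularForms Literature.NumberTheory.Automorphic
  Literature.NumberTheory.EllipticCurves.Rank1Residual
  Summit.BirchSwinnertonDyer.Rank1Residual Summit.BirchSwinnertonDyer.Rank1Residual.X11b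

-- the cell's Theorems namespace repeats the summit name (Summit.<Summit>.<Problem>), as in every sibling file
set_option linter.dupNamespace false

namespace Summit.BirchSwinnertonDyer.BirchSwinnertonDyer.Theorems

/-- **The receptacle-shaped Pasten package WITH (P618)** (shape of
`Literature.NumberTheory.Automorphic.PastenShimura2024_ribetTakahashiPackage`, existential anchor, plus
Lemma 6.18) from the typer's Skolem-function facts: g0's `ribetTakahashiPackage_of_componentOrders` with the
ninth conjunct `κ D q ∣ q − 1` for odd `q ∈ D`, `D ⊆ Mult(E)` even (`CokernelDvd` at the chosen class-minimal
datum of level `(∏D, N/∏D)`; `q ∣ ∏D`). [cite: PastenShimura2024, Prop. 6.13 and §6.6 (p. 23), Lemma 6.8 (p. 22), Lemma 6.14 (p. 23), Lemma 6.18 (p. 24), §2 (p. 12)]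
[cite: PapikianRabinoff2016, Cor. 3.5 (through Pasten Lemma 6.18)] -/
theorem ribetTakahashiPackageCoker_of_componentOrders
    (hCO : PastenShimura2024_componentOrders) (h68 : PastenShimura2024_lemma_6_8_isogeny)
    (hJL : nonempty_shimuraParametrizationData)
    (W : WeierstrassCurve ℚ) [W.IsElliptic] [W.IsGloballyMinimal] (p : ℕ) [Fact p.Prime]
    (hirr : W.HasIrreducibleModPGaloisRep p)
    (N : ℕ) [NeZero N] (W₀ : WeierstrassCurve ℚ) [W₀.IsElliptic] [W₀.IsGloballyMinimal]
    (D₀ : ModularParametrizationData W₀ N)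
    (hN : W.conductorNorm ℤ = N) (hfW : IsNewformOf W D₀.f)
    (hmin : ∀ (W₂ : WeierstrassCurve ℚ) [W₂.IsElliptic] (D₂ : ModularParametrizationData W₂ N),
      D₂.f = D₀.f → D₀.modularDegree ≤ D₂.modularDegree) :
    ∃ (δ : Finset ℕ → ℕ) (cA ι κ : Finset ℕ → ℕ → ℕ),
      δ ∅ = D₀.modularDegree ∧
      (∀ D, 0 < δ D) ∧ (∀ D q, 0 < cA D q) ∧
      -- existential anchor: one class-minimal Shimura datum per admissible level realises `δ D`
      (∀ ⦃D : Finset ℕ⦄, D ⊆ (W.conductorNorm ℤ).primeFactors.filter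
            (fun q ↦ ∃ h : q.Prime, @WeierstrassCurve.HasMultiplicativeReductionAtPrime W q ⟨h⟩) →
          Even D.card →
        ∃ (X : ShimuraCurveData (∏ q ∈ D, q) (N / ∏ q ∈ D, q)) (W' : WeierstrassCurve ℚ)
          (_ : W'.IsElliptic) (P : ShimuraParametrizationData X W'), P.IsMinimalFor W ∧ P.deg = δ D) ∧
      -- (P613)
      (∀ ⦃d : Finset ℕ⦄, d ⊆ (W.conductorNorm ℤ).primeFactors.filter
            (fun q ↦ ∃ h : q.Prime, @WeierstrassCurve.HasMultiplicativeReductionAtPrime W q ⟨h⟩) →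
          Even d.card →
        ∀ ⦃q r : ℕ⦄,
          q ∈ (W.conductorNorm ℤ).primeFactors.filter
            (fun q ↦ ∃ h : q.Prime, @WeierstrassCurve.HasMultiplicativeReductionAtPrime W q ⟨h⟩) →
          r ∈ (W.conductorNorm ℤ).primeFactors.filter
            (fun q ↦ ∃ h : q.Prime, @WeierstrassCurve.HasMultiplicativeReductionAtPrime W q ⟨h⟩) →
          q ∉ d → r ∉ d → q ≠ r →
          δ d * ι d q ^ 2 * κ (insert q (insert r d)) r ^ 2 =
            δ (insert q (insert r d)) * cA d q * cA (insert q (insert r d)) r) ∧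
      -- (Pij)
      (∀ ⦃D : Finset ℕ⦄, D ⊆ (W.conductorNorm ℤ).primeFactors.filter
            (fun q ↦ ∃ h : q.Prime, @WeierstrassCurve.HasMultiplicativeReductionAtPrime W q ⟨h⟩) →
        ∀ ⦃q : ℕ⦄, q ∈ (W.conductorNorm ℤ).primeFactors.filter
            (fun q ↦ ∃ h : q.Prime, @WeierstrassCurve.HasMultiplicativeReductionAtPrime W q ⟨h⟩) →
          ι D q * κ D q = cA D q) ∧
      -- (P68)
      (∀ ⦃D : Finset ℕ⦄, D ⊆ (W.conductorNorm ℤ).primeFactors.filter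
            (fun q ↦ ∃ h : q.Prime, @WeierstrassCurve.HasMultiplicativeReductionAtPrime W q ⟨h⟩) →
        ∃ n : ℕ, 0 < n ∧ ¬ p ∣ n ∧
          ∀ q ∈ (W.conductorNorm ℤ).primeFactors.filter
              (fun q ↦ ∃ h : q.Prime, @WeierstrassCurve.HasMultiplicativeReductionAtPrime W q ⟨h⟩),
            cA D q ∣ n * padicValInt q W.minimalDiscriminantInt ∧
              padicValInt q W.minimalDiscriminantInt ∣ n * cA D q) ∧
      -- (PEis)
      (∀ ⦃d : Finset ℕ⦄, d ⊆ (W.conductorNorm ℤ).primeFactors.filter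
            (fun q ↦ ∃ h : q.Prime, @WeierstrassCurve.HasMultiplicativeReductionAtPrime W q ⟨h⟩) →
        ∀ ⦃q : ℕ⦄, q ∈ (W.conductorNorm ℤ).primeFactors.filter
            (fun q ↦ ∃ h : q.Prime, @WeierstrassCurve.HasMultiplicativeReductionAtPrime W q ⟨h⟩) →
          q ∉ d → ∀ r : ℕ, r.Prime → ¬ r ∣ W.conductorNorm ℤ →
            (ι d q : ℤ) ∣ (r : ℤ) + 1 - W.LFunction r) ∧
      -- (P618) Pasten Lemma 6.18 (Papikian–Rabinoff): the cokernel at an odd prime OF THE LEVEL divides `q − 1`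
      (∀ ⦃D : Finset ℕ⦄, D ⊆ (W.conductorNorm ℤ).primeFactors.filter
            (fun q ↦ ∃ h : q.Prime, @WeierstrassCurve.HasMultiplicativeReductionAtPrime W q ⟨h⟩) →
          Even D.card → ∀ ⦃q : ℕ⦄, q ∈ D → q ≠ 2 → κ D q ∣ q - 1) := by
  have hp : p.Prime := Fact.out
  obtain ⟨cI, cJ, hpos, hProd, h613, hEis, hCok⟩ := hCO
  -- the multiplicative primes: `q ∥ N`
  set Mlt : Finset ℕ := (W.conductorNorm ℤ).primeFactors.filter
    (fun q ↦ ∃ h : q.Prime, @WeierstrassCurve.HasMultiplicativeReductionAtPrime W q ⟨h⟩) with hMlt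
  have hMlt_exact : ∀ q ∈ Mlt, q.Prime ∧ q ∣ N ∧ ¬ q ^ 2 ∣ N := by
    intro q hq
    obtain ⟨hqN, hqp, hm⟩ := Finset.mem_filter.mp hq
    haveI : Fact q.Prime := ⟨hqp⟩
    refine ⟨hqp, hN ▸ (Nat.mem_primeFactors.mp hqN).2.1, hN ▸ not_sq_dvd_conductorNorm_of_mult W q hm⟩
  have hMlt_cpos : ∀ q ∈ Mlt, 0 < padicValInt q W.minimalDiscriminantInt := by
    intro q hq
    obtain ⟨-, hqp, hm⟩ := Finset.mem_filter.mp hq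
    haveI : Fact q.Prime := ⟨hqp⟩
    exact padicValInt_minimalDiscriminantInt_pos_of_mult W q hm
  -- admissible levels and the chosen class-minimal data (Jacquet–Langlands)
  have hNpos : 0 < N := Nat.pos_of_ne_zero (NeZero.ne N)
  have hadm : ∀ D : Finset ℕ, D ⊆ Mlt ∧ Even D.card →
      IsAdmissibleFactorization N (∏ q ∈ D, q) (N / ∏ q ∈ D, q) :=
    fun D h ↦ isAdmissibleFactorization_prod_of_even hNpos (fun ℓ hℓ ↦ hMlt_exact ℓ (h.1 hℓ)) h.2
  have hex : ∀ D : Finset ℕ, D ⊆ Mlt ∧ Even D.card →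
      ∃ (X : ShimuraCurveData (∏ q ∈ D, q) (N / ∏ q ∈ D, q)) (W' : WeierstrassCurve ℚ)
        (_ : W'.IsElliptic) (P : ShimuraParametrizationData X W'), P.IsMinimalFor W := by
    intro D h
    obtain ⟨X⟩ := nonempty_shimuraCurveData_holds (hadm D h)
    obtain ⟨W', hW', P, hP⟩ :=
      ShimuraParametrizationData.exists_isMinimalFor_of_nonempty (hJL (hadm D h) X W hN)
    exact ⟨X, W', hW', P, hP⟩
  choose X W' hW'e P hPmin using hex
  -- the `D = 1` bridge at the empty level: `δ^{Sh}_{1,N} = δ_{1,N}`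
  have hbridge : ∀ {Dn Mn : ℕ} (_ : Dn = 1) (_ : Mn = N) {Xe : ShimuraCurveData Dn Mn}
      {We : WeierstrassCurve ℚ} [We.IsElliptic] {Pe : ShimuraParametrizationData Xe We},
      Pe.IsMinimalFor W → Pe.deg = D₀.modularDegree := by
    intro Dn Mn hD hM Xe We _ Pe hPe
    subst hD; subst hM
    exact hPe.deg_eq_modularDegree D₀ hfW hmin
  -- the four functions
  refine ⟨fun D ↦ if h : D ⊆ Mlt ∧ Even D.card then (P D h).deg else D₀.modularDegree,
    fun D q ↦ if h : D ⊆ Mlt ∧ Even D.card then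
        (if q ∈ Mlt then ((W' D h).minimalDiscriminantNorm ℤ).factorization q else 1)
      else (if q ∈ Mlt then padicValInt q W.minimalDiscriminantInt else 1),
    fun D q ↦ if h : D ⊆ Mlt ∧ Even D.card then cI (P D h) q else 1,
    fun D q ↦ if h : D ⊆ Mlt ∧ Even D.card then cJ (P D h) q
      else (if q ∈ Mlt then padicValInt q W.minimalDiscriminantInt else 1),
    ?_, ?_, ?_, ?_, ?_, ?_, ?_, ?_, ?_⟩
  ---------------------------------------------------------------- pin
  · have h0 : (∅ : Finset ℕ) ⊆ Mlt ∧ Even (∅ : Finset ℕ).card := ⟨Finset.empty_subset _, by simp⟩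
    simp only [dif_pos h0]
    haveI := hW'e ∅ h0
    exact hbridge Finset.prod_empty (by rw [Finset.prod_empty, Nat.div_one]) (hPmin ∅ h0)
  ---------------------------------------------------------------- positivity of `δ`
  · intro D
    by_cases h : D ⊆ Mlt ∧ Even D.card
    · simp only [dif_pos h]; exact (P D h).deg_pos
    · simp only [dif_neg h]; exact D₀.deg_pos
  ---------------------------------------------------------------- positivity of `cA`
  · intro D q
    by_cases h : D ⊆ Mlt ∧ Even D.card
    · by_cases hq : q ∈ Mlt
      · simp only [dif_pos h, if_pos hq]
        haveI := hW'e D h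
        obtain ⟨hqp, hqN, hq2⟩ := hMlt_exact q hq
        have := hProd (hadm D h) (X D h) W hN (W' D h) (P D h) (hPmin D h) q hqp hqN hq2
        rw [← this]
        exact Nat.mul_pos (hpos (P D h) q).1 (hpos (P D h) q).2
      · simp only [dif_pos h, if_neg hq]; exact one_pos
    · by_cases hq : q ∈ Mlt
      · simp only [dif_neg h, if_pos hq]; exact hMlt_cpos q hq
      · simp only [dif_neg h, if_neg hq]; exact one_pos
  ---------------------------------------------------------------- existential anchor
  · intro D hD hDe
    have h : D ⊆ Mlt ∧ Even D.card := ⟨hD, hDe⟩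
    refine ⟨X D h, W' D h, hW'e D h, P D h, hPmin D h, ?_⟩
    simp only [dif_pos h]
  ---------------------------------------------------------------- (P613)
  · intro d hd hde q r hq hr hqd hrd hqr
    have hq' : q ∉ insert r d := by simp [hqr, hqd]
    set D' : Finset ℕ := insert q (insert r d) with hD'
    have hdA : d ⊆ Mlt ∧ Even d.card := ⟨hd, hde⟩
    have hD'A : D' ⊆ Mlt ∧ Even D'.card := by
      refine ⟨?_, ?_⟩
      · intro x hx
        rcases Finset.mem_insert.mp hx with rfl | hx
        · exact hq
        rcases Finset.mem_insert.mp hx with rfl | hx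
        · exact hr
        · exact hd hx
      · rw [hD', Finset.card_insert_of_notMem hq', Finset.card_insert_of_notMem hrd]
        obtain ⟨k, hk⟩ := hde
        exact ⟨k + 1, by omega⟩
    obtain ⟨hqp, -, -⟩ := hMlt_exact q hq
    obtain ⟨hrp, -, -⟩ := hMlt_exact r hr
    haveI := hW'e d hdA
    haveI := hW'e D' hD'A
    -- the level arithmetic: `∏D' = (∏d)·(q·r)` and `N/∏d = q·r·(N/∏D')`
    have hprod : ∏ x ∈ D', x = (∏ x ∈ d, x) * (q * r) := by
      rw [hD', Finset.prod_insert hq', Finset.prod_insert hrd]; ring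
    have hadmD' := hadm D' hD'A
    have hdivD' : (∏ x ∈ D', x) * (N / ∏ x ∈ D', x) = N := hadmD'.mul_eq
    have hdpos : 0 < ∏ x ∈ d, x := Finset.prod_pos fun x hx ↦ (hMlt_exact x (hd hx)).1.pos
    have hlevel : N / ∏ x ∈ d, x = q * r * (N / ∏ x ∈ D', x) := by
      have : N = (∏ x ∈ d, x) * (q * r * (N / ∏ x ∈ D', x)) := by
        rw [← mul_assoc, ← hprod]; exact hdivD'.symm
      conv_lhs => rw [this]
      rw [Nat.mul_div_cancel_left _ hdpos]
    have key := h613 hqp hrp hqr hprod hlevel hadmD' (X d hdA) (X D' hD'A) W hN (W' d hdA) (P d hdA)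
      (hPmin d hdA) (W' D' hD'A) (P D' hD'A) (hPmin D' hD'A)
    -- unfold the four functions at the admissible levels `d`, `D'`
    simp only [dif_pos hdA, dif_pos hD'A, if_pos hq, if_pos hr]
    calc (P d hdA).deg * cI (P d hdA) q ^ 2 * cJ (P D' hD'A) r ^ 2
        = (P d hdA).deg * (cI (P d hdA) q ^ 2 * cJ (P D' hD'A) r ^ 2) := by ring
      _ = (P D' hD'A).deg * (((W' d hdA).minimalDiscriminantNorm ℤ).factorization q *
            ((W' D' hD'A).minimalDiscriminantNorm ℤ).factorization r) := key
      _ = _ := by ring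
  ---------------------------------------------------------------- (Pij)
  · intro D hD q hq
    by_cases h : D ⊆ Mlt ∧ Even D.card
    · haveI := hW'e D h
      obtain ⟨hqp, hqN, hq2⟩ := hMlt_exact q hq
      simp only [dif_pos h, if_pos hq]
      exact hProd (hadm D h) (X D h) W hN (W' D h) (P D h) (hPmin D h) q hqp hqN hq2
    · simp only [dif_neg h, if_pos hq, one_mul]
  ---------------------------------------------------------------- (P68)
  · intro D hD
    by_cases h : D ⊆ Mlt ∧ Even D.card
    · haveI := hW'e D h
      -- an isogeny `W → A_D` of degree prime to `p` (`E[p]` irreducible)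
      have hp0 : (p : ℚ) ≠ 0 := by exact_mod_cast hp.ne_zero
      obtain ⟨lam, hlam⟩ :=
        Literature.NumberTheory.EllipticCurves.SkinnerUrban2014.exists_isogeny_not_dvd_degree_of_irreducible
          hp0 hirr (hPmin D h).1
      refine ⟨lam.degree, lam.degree_pos, hlam, fun q hq ↦ ?_⟩
      obtain ⟨hqp, hqN, hq2⟩ := hMlt_exact q hq
      obtain ⟨a, b, ha, hb, haD, hbD, hEq⟩ := h68 W (W' D h) lam q hqp (hN ▸ hqN) (hN ▸ hq2)
      simp only [dif_pos h, if_pos hq]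
      rw [padicValInt_minimalDiscriminantInt_eq_factorization W hqp]
      set cW := (W.minimalDiscriminantNorm ℤ).factorization q
      set cW' := ((W' D h).minimalDiscriminantNorm ℤ).factorization q
      -- `cW · b = a · cW'` with `a, b ∣ deg λ`
      refine ⟨?_, ?_⟩
      · -- `cW' ∣ deg λ · cW`
        have h1 : cW' ∣ cW * b := ⟨a, by rw [hEq]; ring⟩
        exact h1.trans (by rw [mul_comm]; exact Nat.mul_dvd_mul_right hbD cW)
      · -- `cW ∣ deg λ · cW'`
        have h1 : cW ∣ a * cW' := ⟨b, by rw [← hEq]⟩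
        exact h1.trans (Nat.mul_dvd_mul_right haD cW')
    · refine ⟨1, one_pos, hp.one_lt.ne' ∘ (Nat.dvd_one.mp ·), fun q hq ↦ ?_⟩
      simp only [dif_neg h, if_pos hq, one_mul, dvd_refl, and_self]
  ---------------------------------------------------------------- (PEis)
  · intro d hd q hq hqd r' hr' hr'N
    by_cases h : d ⊆ Mlt ∧ Even d.card
    · haveI := hW'e d h
      obtain ⟨hqp, hqN, hq2⟩ := hMlt_exact q hq
      have hadmd := hadm d h
      -- `q ∥ N/∏d`: `q` is a multiplicative prime outside `d`
      have hqprod : ¬ q ∣ ∏ x ∈ d, x := by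
        intro hdiv
        obtain ⟨x, hx, hqx⟩ := (Prime.dvd_finsetProd_iff hqp.prime _).mp hdiv
        have : q = x := (Nat.prime_dvd_prime_iff_eq hqp (hMlt_exact x (hd hx)).1).mp hqx
        exact hqd (this ▸ hx)
      have hqM : q ∣ N / ∏ x ∈ d, x := by
        have : q ∣ (∏ x ∈ d, x) * (N / ∏ x ∈ d, x) := by rw [hadmd.mul_eq]; exact hqN
        exact ((Nat.Prime.dvd_mul hqp).mp this).resolve_left hqprod
      have hq2M : ¬ q ^ 2 ∣ N / ∏ x ∈ d, x := fun h2 ↦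
        hq2 (h2.trans (Nat.div_dvd_of_dvd (Dvd.intro _ hadmd.mul_eq)))
      have key := hEis hadmd (X d h) W hN (W' d h) (P d h) (hPmin d h) q hqp hqM hq2M r' hr'
        (hN ▸ hr'N)
      simp only [dif_pos h]
      rw [LFunction_eq_of_isIsogenous_holds W (W' d h) (hPmin d h).1]
      exact_mod_cast key
    · simp only [dif_neg h, Nat.cast_one, one_dvd]

  ---------------------------------------------------------------- (P618)
  · intro D hD hDe q hqD hq2
    have h : D ⊆ Mlt ∧ Even D.card := ⟨hD, hDe⟩
    haveI := hW'e D h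
    obtain ⟨hqp, -, -⟩ := hMlt_exact q (hD hqD)
    have hqdvd : q ∣ ∏ x ∈ D, x := Finset.dvd_prod_of_mem _ hqD
    simp only [dif_pos h]
    exact (hCok (hadm D h) (X D h) W hN (W' D h) (P D h) (hPmin D h) q hqp hqdvd).1 hq2

end Summit.BirchSwinnertonDyer.BirchSwinnertonDyer.Theorems

end
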